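import Summits.QuantumFields.BalabanUV.Beta.FP.PerfectColumnKronecker
import Summits.QuantumFields.BalabanUV.Beta.D1BFx.MomentTransferKroneckerWard

/-!
# `BalabanUV.Beta.FP.StepLawWard` — road «FP» for binder row D1, node N2-asm ∕ END: THE (1.22) STEP LAW OF THE PERFECT COEFFICIENT FAMILY WITHOUT THE
# FIRST-MOMENT INPUT (T1) — i.e. WITHOUT an2's ROW hR: the transport of the ONE entry `(κ, λ, a, b) = (μ, ν, μ, ν)` that the read-out consumes needs
# only the KRONECKER COLUMN (proved), (T0) + the DIAGONAL first moments (both from `WardTransversal (flipK T)` alone) and the TRANSPOSITION SYMMETRY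
# `T c e t = T e c (−t)` of the perfect one-step kernel

HONEST DEPENDENCY (page 1, mandatory): continuum YM on T⁴ ⇐ BetaPertH ∧ nine spine estimates (0/9 proved); BetaPertH ⇐ (D1) ∧ (D4) ∧
CAP+tail; G-an2-4 gates asym, D1 and NE2/3/4.  HONEST FRAMING (cell contract, verbatim): «discharging `BetaPertH` makes Bałaban's UV
stability UNCONDITIONAL — a real constructive-QFT result; it is NOT the continuum limit and NOT the Clay problem.»  THIS MODULE DISCHARGES
NOTHING of D1 / BetaPertH: [our object] ∕ [folklore] bookkeeping BY NAME over this lineage's `StepLawAssembly` (gen 1) ∕ `StepLawKHolds` (leaf-06) and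
`MomentTransferKronecker(Ward)` ∕ `PerfectColumnKronecker` (gen 4).  No `def`, no `Prop` mirror, no cited fact, 0 sorry; every analytic input is a DISPLAYED
hypothesis; 0∕4 binders of row D1 discharged; NOT D1, NOT BetaPertH, NOT continuum, NOT Clay.

ABSOLUTE RULE (cell charter, verbatim): «No internally-minted statement may enter as a cited fact. Every hypothesis is either
kernel-proved in this package or a verbatim quotation of a PUBLISHED theorem with page reference. The manuscript(s) under audit are NOT
citable for their own disputed steps — they are the thing under adjudication; programme-internal (2001/route/tribunal) claims are never
citable.»

WHY (located fact, tree read 2026-08-20T15:00Z).  In road FP the wall's reflection row `hRj : ∀ j, AxisReflectionCovariant (flipK (TbalOf … j))` (an2's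
hR, one of the four binders of row D1) is consumed in exactly ONE place: `StepLawKHolds.fPerf_succ_of_rows_holdsK` turns it into
`AxisReflectionCovariant (flipK (TPerf 1))` and then (`StepLawAssembly.wardData_of_printed_flip`) into the first moments (T1) of the perfect ONE-step kernel,
which enter an4's `hasSum_transport_m2Tensor` through `EntryHyps.T1` inside `m2Tensor_succ_of_fubini`.  But the (1.22) read-out uses only the tensor ENTRY
`(μ, ν, μ, ν)` (`secondMoment_eq_m2Tensor`), and for that entry this lineage's `MomentTransferKronecker.bondSecondMomentP_hasSum_four_of_diag` transports
WITHOUT (T1): it asks the Kronecker first-moment row of the column (PROVED for the perfect column: `PerfectColumnKronecker`), (T0) and the DIAGONAL first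
moments — both consequences of `WardTransversal (flipK T)` (§2: an2's `hasSum_zero_of_divFree` and gen 4's `hasSum_diagFirstMoment_of_divFree` on the
flipped kernel) — and the transposition symmetry `T c e t = T e c (−t)` (Hessian symmetry of a polarization kernel — structural; on the road: table symmetry
+ coarse covariance + `bubble_comm`, a separate supplier).  So the step law, and with it road FP's END, can be stated with `hRj` REPLACED by that symmetry:
file `FP/StepLawWardRows`.

CONTENT.
* §1 [folklore] `hasSum_transport_entry_of_ward` (abstract `EKer 4`, translation-invariant kernel: the ENTRY transport
  `HasSum (z ↦ (z_κ z_λ) • (N⁸ · dressedEntry w T (N•z) a b)) (m2Tensor T κ λ a b)` for `κ, λ ∈ {a, b}` from Kronecker column + AbsMoment₂ + symmetry + (T0)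
  + diagonal (T1)); **`secondMoment_succ_of_fubini_ward`** (= `StepLawAssembly.secondMoment_succ_of_fubini` with the door `hadm : EntryHyps` ↦ those data).
* §2 [folklore] **`wardDiag_of_ward_flip`**: `AbsMoment₂` + `WardTransversal (flipK T)` ⟹ (T0) ∧ the DIAGONAL (T1) `Σ_t t_c · T c e t = 0`.
* §3 [our object] **`fPerf_succ_of_fubini_ward_holdsK`** (= `StepLawKHolds.fPerf_succ_of_fubini_holdsK` with `hT1` ↦ `hTsymm` + diagonal (T1); K-side incl.
  the Kronecker row UNCONDITIONAL, `d = 3`, `2 ≤ Lc`) and **`fPerf_succ_of_fubini_wardFlip_holdsK`** (= `…_flip_holdsK` with `hRf` ↦ `hTsymm`).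
Unit `b2b-balaban-beta-d1-formalise-leaf-02` (gen 4).
-/

noncomputable section

namespace Summit.QuantumFields.BalabanUV.Beta.FP.StepLawWard

open Finset Filter Topology
open scoped BigOperators
open Literature.MathematicalPhysics.QuantumFieldTheory.Balaban1983to89
open Literature.MathematicalPhysics.QuantumFieldTheory.Balaban1983to89.Beta
open B12Beta (secondMoment)
open B6BondElimination (unitVec)
open DecimatedMomentSummable (IsMoment₂ ConstReproSum LinReproSum AbsMoment₂ summable_smul_of_absMoment₂)
open DressedMomentNormalisation (EKer resSite m2Tensor dressedEntry EntryHyps)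
open ExpKernelCalculus (MKer Decays VertexFamily₂)
open PolarizationSign (WardTransversal)
open OneStepResolventKernel (Fib LocStencil)
open OneStepKernelFamily (flipK)
open KernelRepresentationSummable (hasSum_zero_of_divFree)
open Summit.QuantumFields.BalabanUV.Beta.GAN24.CombesThomas (sfStep smStep)
open Summit.QuantumFields.BalabanUV.Beta.D1BFx.MomentTransferPeriodic (IsBlockPeriodic baseKer isBlockPeriodic_of_transl baseKer_of_transl)
open Summit.QuantumFields.BalabanUV.Beta.D1BFx.MomentTransferPeriodicEntry (EKer₂ dressedEntryP avgM2 dressedEntryP_of_transl avgM2_of_transl)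
open Summit.QuantumFields.BalabanUV.Beta.D1BFx.MomentTransferKronecker (bondSecondMomentP_hasSum_four_of_diag)
open Summit.QuantumFields.BalabanUV.Beta.D1BFx.MomentTransferKroneckerWard (hasSum_diagFirstMoment_of_divFree)
open Summit.QuantumFields.BalabanUV.Beta.D1BFx.FineHessianWard (unitVec_eq_single)
open Summit.QuantumFields.BalabanUV.Beta.FP.PerfectObjectsT (KPerf SPerfOf WPerfOf TPerfOf fPerf fPerf_def)
open Summit.QuantumFields.BalabanUV.Beta.FP.TransportInfinityM (colOf)
open Summit.QuantumFields.BalabanUV.Beta.FP.StepLawAssembly (secondMoment_eq_m2Tensor hdec_TPerfOf absMoment₂_TPerfOf)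
open Summit.QuantumFields.BalabanUV.Beta.FP.StepLawKHolds (exists_decays_KPerf_holds)
open Summit.QuantumFields.BalabanUV.Beta.FP.PerfectBubbleSandwich (absMoment₂_reflect entryHyps_perfCol_zero)
open Summit.QuantumFields.BalabanUV.Beta.FP.PerfectColumnKronecker (linReproSum_kronecker_of_offDiag linReproSum_perfCol_offDiag_holds)

/-! ## §1 The abstract socket: the entry transport without (T1), and one more step at the (1.22) read-out -/

section Abstract

/-- [folklore] **THE ENTRY TRANSPORT WITHOUT (T1)** (translation-invariant matrix kernel `T`, blocking `N ≥ 1`).  Column `w` with Kronecker masses, SOME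
(L1∞) constants and ZERO off-diagonal ones, absolutely summable second moments; `T` with absolutely summable second moments, TRANSPOSITION-SYMMETRIC
(`T c e t = T e c (−t)`), every entry summing to zero ((T0)) and with vanishing DIAGONAL first moment (`Σ_t t_c · T c e t = 0`): for `κ, λ ∈ {a, b}` the
decimated second moment of the `(a, b)` entry of `N⁸ · dressedEntry w T (N • ·)` HAS THE SUM `m2Tensor T κ λ a b` — an4's `hasSum_transport_m2Tensor`
AT THAT ENTRY with `EntryHyps.T1` replaced (`MomentTransferKronecker.bondSecondMomentP_hasSum_four_of_diag` at `P c e s s' := T c e (s − s')`). -/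
theorem hasSum_transport_entry_of_ward {N : ℕ} (hN : 0 < N) (w T : EKer 4)
    (hw0 : ∀ κ l, ConstReproSum N (w κ l) (if κ = l then (((N : ℝ) ^ (4 + 1))⁻¹) else 0))
    (hw1 : ∀ κ l, ∃ C : Fin 4 → ℝ, LinReproSum N (w κ l) C) (hw1off : ∀ κ l, κ ≠ l → LinReproSum N (w κ l) 0)
    (hwA : ∀ κ l, AbsMoment₂ (w κ l)) (hTA : ∀ c e, AbsMoment₂ (T c e)) (hTsymm : ∀ c e t, T c e t = T e c (-t))
    (hT0 : ∀ c e, HasSum (T c e) 0) (hT1d : ∀ c e, HasSum (fun t : Fin 4 → ℤ => (t c : ℝ) * T c e t) 0)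
    {κ lam a b : Fin 4} (hκ : κ = a ∨ κ = b) (hlam : lam = a ∨ lam = b) :
    HasSum (fun z : Fin 4 → ℤ => (z κ * z lam) • ((N : ℝ) ^ 8 * dressedEntry w T ((N : ℤ) • z) a b)) (m2Tensor T κ lam a b) := by
  obtain ⟨C1, hC1⟩ := linReproSum_kronecker_of_offDiag hw1 hw1off
  have hP : ∀ c e, IsBlockPeriodic N ((fun c e (s s' : Fin 4 → ℤ) => T c e (s - s')) c e) := fun c e => isBlockPeriodic_of_transl (T c e)
  have hsymm : ∀ c e (s s' : Fin 4 → ℤ), (fun c e (s s' : Fin 4 → ℤ) => T c e (s - s')) c e s s'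
      = (fun c e (s s' : Fin 4 → ℤ) => T c e (s - s')) e c s' s := fun c e s s' => by
    show T c e (s - s') = T e c (s' - s)
    rw [hTsymm c e (s - s'), neg_sub]
  have hPA : ∀ c e (b' : Fin 4 → ℤ), AbsMoment₂ (baseKer ((fun c e (s s' : Fin 4 → ℤ) => T c e (s - s')) c e) b') := fun c e b' => by
    show AbsMoment₂ (baseKer (fun s s' => T c e (s - s')) b')
    rw [baseKer_of_transl]; exact hTA c e
  have hrow : ∀ c e (b' : Fin 4 → ℤ), HasSum ((fun c e (s s' : Fin 4 → ℤ) => T c e (s - s')) c e b') 0 :=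
    fun c e b' => (Equiv.hasSum_iff (Equiv.subLeft b')).mpr (hT0 c e)
  have hT1d' : ∀ c e, ∑ r : Fin 4 → Fin N, ∑' t, (t c : ℝ) * baseKer ((fun c e (s s' : Fin 4 → ℤ) => T c e (s - s')) c e) (resSite r) t = 0 :=
    fun c e => by
    have e1 : ∀ r : Fin 4 → Fin N, ∑' t, (t c : ℝ) * baseKer ((fun c e (s s' : Fin 4 → ℤ) => T c e (s - s')) c e) (resSite r) t = 0 := fun r => by
      show ∑' t, (t c : ℝ) * baseKer (fun s s' => T c e (s - s')) (resSite r) t = 0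
      rw [baseKer_of_transl]; exact (hT1d c e).tsum_eq
    exact Finset.sum_eq_zero fun r _ => e1 r
  have h := bondSecondMomentP_hasSum_four_of_diag hN w (fun c e (s s' : Fin 4 → ℤ) => T c e (s - s')) hP hsymm hw0 hC1 hwA hPA hrow hT1d'
    hκ hlam
  rw [dressedEntryP_of_transl, avgM2_of_transl hN] at h
  have e : m2Tensor T κ lam a b = ∑' t : Fin 4 → ℤ, (t κ : ℝ) * (t lam : ℝ) * T a b t := by
    show (∑' t : Fin 4 → ℤ, (t κ * t lam) • T a b t) = _
    exact tsum_congr (fun t => by rw [zsmul_eq_mul, Int.cast_mul])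
  rw [e]
  refine h.congr_fun (fun z => ?_)
  rw [zsmul_eq_mul, Int.cast_mul]

variable {TP w D : ℕ → EKer 4} {N : ℕ → ℕ}

/-- [folklore] **ONE MORE PERFECT STEP AT THE (1.22) READ-OUT — WITHOUT (T1).**  `StepLawAssembly.secondMoment_succ_of_fubini` with its admissibility door
`hadm : EntryHyps (N m) (w m) (TP 1)` REPLACED by: Kronecker masses + SOME (L1∞) constants with the off-diagonal ones ZERO + AbsMoment₂ of the columns, and
for the one-step kernel `TP 1`: AbsMoment₂, transposition symmetry, (T0), DIAGONAL (T1).  Conclusion unchanged: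
`∀ m ≥ 1, secondMoment (TP (m+1)) μ ν = secondMoment (TP m) μ ν + secondMoment (TP 1) μ ν`. -/
theorem secondMoment_succ_of_fubini_ward
    (hfub : ∀ m : ℕ, 1 ≤ m → ∀ (a b : Fin 4) (z : Fin 4 → ℤ),
      TP (m + 1) a b z = ((N m : ℕ) : ℝ) ^ 8 * dressedEntry (w m) (TP 1) (((N m : ℕ) : ℤ) • z) a b + TP m a b z + D m a b z)
    (hN : ∀ m : ℕ, 1 ≤ m → 0 < N m)
    (hw0 : ∀ m : ℕ, 1 ≤ m → ∀ κ l, ConstReproSum (N m) (w m κ l) (if κ = l then ((((N m : ℕ) : ℝ) ^ (4 + 1))⁻¹) else 0))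
    (hw1 : ∀ m : ℕ, 1 ≤ m → ∀ κ l, ∃ C : Fin 4 → ℝ, LinReproSum (N m) (w m κ l) C)
    (hw1off : ∀ m : ℕ, 1 ≤ m → ∀ κ l, κ ≠ l → LinReproSum (N m) (w m κ l) 0) (hwA : ∀ m : ℕ, 1 ≤ m → ∀ κ l, AbsMoment₂ (w m κ l))
    (hTA : ∀ c e, AbsMoment₂ (TP 1 c e)) (hTsymm : ∀ c e t, TP 1 c e t = TP 1 e c (-t)) (hT0 : ∀ c e, HasSum (TP 1 c e) 0)
    (hT1d : ∀ c e, HasSum (fun t : Fin 4 → ℤ => (t c : ℝ) * TP 1 c e t) 0)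
    (hA : ∀ m : ℕ, 1 ≤ m → ∀ a b : Fin 4, AbsMoment₂ (TP m a b)) (hDA : ∀ m : ℕ, 1 ≤ m → ∀ a b : Fin 4, AbsMoment₂ (D m a b))
    (μ ν : Fin 4) (hSDF : ∀ m : ℕ, 1 ≤ m → secondMoment (D m) μ ν = 0) :
    ∀ m : ℕ, 1 ≤ m → secondMoment (TP (m + 1)) μ ν = secondMoment (TP m) μ ν + secondMoment (TP 1) μ ν := by
  intro m hm
  have h1 := hasSum_transport_entry_of_ward (hN m hm) (w m) (TP 1) (hw0 m hm) (hw1 m hm) (hw1off m hm) (hwA m hm) hTA hTsymm hT0 hT1d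
    (κ := μ) (lam := ν) (a := μ) (b := ν) (Or.inl rfl) (Or.inr rfl)
  have h2 : Summable (fun t : Fin 4 → ℤ => (t μ * t ν) • TP m μ ν t) := summable_smul_of_absMoment₂ (hA m hm μ ν) (IsMoment₂.coord2 μ ν)
  have h3 : Summable (fun t : Fin 4 → ℤ => (t μ * t ν) • D m μ ν t) := summable_smul_of_absMoment₂ (hDA m hm μ ν) (IsMoment₂.coord2 μ ν)
  have hten : m2Tensor (TP (m + 1)) μ ν μ ν = m2Tensor (TP 1) μ ν μ ν + m2Tensor (TP m) μ ν μ ν + m2Tensor (D m) μ ν μ ν := by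
    calc m2Tensor (TP (m + 1)) μ ν μ ν
        = ∑' t : Fin 4 → ℤ, (((t μ * t ν) • (((N m : ℕ) : ℝ) ^ 8 * dressedEntry (w m) (TP 1) (((N m : ℕ) : ℤ) • t) μ ν)
            + (t μ * t ν) • TP m μ ν t) + (t μ * t ν) • D m μ ν t) := by
          show (∑' t : Fin 4 → ℤ, (t μ * t ν) • TP (m + 1) μ ν t) = _
          exact tsum_congr fun t => by rw [hfub m hm μ ν t, smul_add, smul_add]
      _ = m2Tensor (TP 1) μ ν μ ν + m2Tensor (TP m) μ ν μ ν + m2Tensor (D m) μ ν μ ν := by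
          rw [Summable.tsum_add (h1.summable.add h2) h3, Summable.tsum_add h1.summable h2, h1.tsum_eq]
          rfl
  rw [secondMoment_eq_m2Tensor, secondMoment_eq_m2Tensor, secondMoment_eq_m2Tensor, hten, ← secondMoment_eq_m2Tensor (D m), hSDF m hm,
    add_zero, add_comm]

end Abstract

/-! ## §2 (T0) and the DIAGONAL (T1) from the Ward row of the flipped kernel alone -/

/-- [folklore] **(T0) AND THE DIAGONAL FIRST MOMENTS FROM `WardTransversal (flipK T)`** (absolutely summable second moments): the flipped kernel is
first-index divergence-free in the backward-difference form, so an2's `hasSum_zero_of_divFree` gives (T0) and gen 4's quadratic-gauge Ward identity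
`hasSum_diagFirstMoment_of_divFree` gives `Σ_t t_c · T c e (−t) = 0`, i.e. `Σ_t t_c · T c e t = 0`.  NO reflection law is used: the OFF-diagonal first
moments (which `AxisReflectionCovariant` would also kill) are simply not produced. -/
theorem wardDiag_of_ward_flip {T : EKer 4} (hTA : ∀ c e, AbsMoment₂ (T c e)) (hWf : WardTransversal (flipK T)) :
    (∀ c e, HasSum (T c e) 0) ∧ (∀ c e, HasSum (fun t : Fin 4 → ℤ => (t c : ℝ) * T c e t) 0) := by
  set K : Fin 4 → Fin 4 → (Fin 4 → ℤ) → ℝ := fun μ ν x => T μ ν (-x) with hK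
  have hKA : ∀ μ ν, AbsMoment₂ (K μ ν) := fun μ ν => absMoment₂_reflect (hTA μ ν)
  have hdiv : ∀ (ν : Fin 4) (x : Fin 4 → ℤ), ∑ μ, (K μ ν x - K μ ν (x - Pi.single μ 1)) = 0 := by
    intro ν x
    have h := hWf ν x
    rw [← neg_eq_zero, ← Finset.sum_neg_distrib] at h
    rw [← h]
    refine Finset.sum_congr rfl fun μ _ => ?_
    rw [neg_sub, unitVec_eq_single]
    rfl
  refine ⟨fun c e => ?_, fun c e => ?_⟩
  · exact (Equiv.neg (Fin 4 → ℤ)).hasSum_iff.mp ((hasSum_zero_of_divFree K hKA hdiv c e).congr_fun fun x => rfl)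
  · have h1 := (hasSum_diagFirstMoment_of_divFree K hKA hdiv c e).neg
    rw [neg_zero] at h1
    have e1 : (fun t : Fin 4 → ℤ => (t c : ℝ) * T c e t) ∘ (Equiv.neg (Fin 4 → ℤ)) = fun y => -((y c : ℝ) * K c e y) := by
      funext y
      simp only [Function.comp_apply, Equiv.neg_apply, Pi.neg_apply, Int.cast_neg, hK]
      ring
    exact (Equiv.neg (Fin 4 → ℤ)).hasSum_iff.mp (e1 ▸ h1)

/-! ## §3 The socket at the perfect family, K-side unconditional: `hT1` ∕ `hRf` replaced by transposition symmetry -/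

section Perfect

variable {Lc : ℕ} [NeZero Lc]
  (S : ℕ → ℕ → Fin (3 + 1) → (Fin (3 + 1) → ℤ) → MKer (3 + 1) (Fib 3))
  (Wt : ℕ → ℕ → Fin (3 + 1) → (Fin (3 + 1) → ℤ) → Fin (3 + 1) → (Fin (3 + 1) → ℤ) → MKer (3 + 1) (Fib 3))
  {D : ℕ → EKer 4}

/-- [our object] **THE STEP LAW OF THE PERFECT COEFFICIENT FAMILY FROM THE N2 INPUTS, X1m-K DISCHARGED, WITHOUT (T1)** (`d = 3`, `2 ≤ Lc`, adopted units):
`StepLawKHolds.fPerf_succ_of_fubini_holdsK` with its binder `hT1` (ALL first moments of the perfect one-step kernel) REPLACED by the DIAGONAL first moments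
`hT1d` + the transposition symmetry `hTsymm`; the column side — Kronecker masses, (L1∞), the Kronecker first-moment row, AbsMoment₂ — is UNCONDITIONAL
(`entryHyps_perfCol_zero`, `linReproSum_perfCol_offDiag_holds`).  CONCLUSION: `∀ m ≥ 1, fPerf … (m+1) = fPerf … m + fPerf … 1`. -/
theorem fPerf_succ_of_fubini_ward_holdsK (hLc : 2 ≤ Lc)
    (hT : ∀ a b, AbsMoment₂ (TPerfOf Lc (KPerf Lc (sfStep Lc) (smStep 3 Lc) 1) (SPerfOf (sfStep Lc) (smStep 3 Lc) S 1)
      (WPerfOf (sfStep Lc) (smStep 3 Lc) Wt 1) a b))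
    (hTsymm : ∀ a b t, TPerfOf Lc (KPerf Lc (sfStep Lc) (smStep 3 Lc) 1) (SPerfOf (sfStep Lc) (smStep 3 Lc) S 1)
        (WPerfOf (sfStep Lc) (smStep 3 Lc) Wt 1) a b t
      = TPerfOf Lc (KPerf Lc (sfStep Lc) (smStep 3 Lc) 1) (SPerfOf (sfStep Lc) (smStep 3 Lc) S 1) (WPerfOf (sfStep Lc) (smStep 3 Lc) Wt 1) b a (-t))
    (hT0 : ∀ a b, HasSum (TPerfOf Lc (KPerf Lc (sfStep Lc) (smStep 3 Lc) 1) (SPerfOf (sfStep Lc) (smStep 3 Lc) S 1)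
      (WPerfOf (sfStep Lc) (smStep 3 Lc) Wt 1) a b) 0)
    (hT1d : ∀ a b, HasSum (fun t : Fin 4 → ℤ => (t a : ℝ) * TPerfOf Lc (KPerf Lc (sfStep Lc) (smStep 3 Lc) 1) (SPerfOf (sfStep Lc) (smStep 3 Lc) S 1)
      (WPerfOf (sfStep Lc) (smStep 3 Lc) Wt 1) a b t) 0)
    (hA : ∀ m : ℕ, 1 ≤ m → ∀ a b, AbsMoment₂ (TPerfOf (Lc ^ m) (KPerf Lc (sfStep Lc) (smStep 3 Lc) m) (SPerfOf (sfStep Lc) (smStep 3 Lc) S m)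
      (WPerfOf (sfStep Lc) (smStep 3 Lc) Wt m) a b))
    (hDA : ∀ m : ℕ, 1 ≤ m → ∀ a b, AbsMoment₂ (D m a b))
    (hfub : ∀ m : ℕ, 1 ≤ m → ∀ (a b : Fin 4) (z : Fin 4 → ℤ),
      TPerfOf (Lc ^ (m + 1)) (KPerf Lc (sfStep Lc) (smStep 3 Lc) (m + 1)) (SPerfOf (sfStep Lc) (smStep 3 Lc) S (m + 1))
          (WPerfOf (sfStep Lc) (smStep 3 Lc) Wt (m + 1)) a b z
        = ((Lc ^ m : ℕ) : ℝ) ^ 8 * dressedEntry (colOf (KPerf (d := 3) Lc (sfStep Lc) (smStep 3 Lc) m))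
            (TPerfOf Lc (KPerf Lc (sfStep Lc) (smStep 3 Lc) 1) (SPerfOf (sfStep Lc) (smStep 3 Lc) S 1) (WPerfOf (sfStep Lc) (smStep 3 Lc) Wt 1))
            (((Lc ^ m : ℕ) : ℤ) • z) a b
          + TPerfOf (Lc ^ m) (KPerf Lc (sfStep Lc) (smStep 3 Lc) m) (SPerfOf (sfStep Lc) (smStep 3 Lc) S m) (WPerfOf (sfStep Lc) (smStep 3 Lc) Wt m) a b z
          + D m a b z)
    (μ ν : Fin 4) (hSDF : ∀ m : ℕ, 1 ≤ m → secondMoment (D m) μ ν = 0) :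
    ∀ m : ℕ, 1 ≤ m → fPerf Lc (sfStep Lc) (smStep 3 Lc) S Wt μ ν (m + 1) =
      fPerf Lc (sfStep Lc) (smStep 3 Lc) S Wt μ ν m + fPerf Lc (sfStep Lc) (smStep 3 Lc) S Wt μ ν 1 := by
  set TP : ℕ → EKer 4 := fun m => TPerfOf (Lc ^ m) (KPerf Lc (sfStep Lc) (smStep 3 Lc) m) (SPerfOf (sfStep Lc) (smStep 3 Lc) S m)
    (WPerfOf (sfStep Lc) (smStep 3 Lc) Wt m) with hTP
  have hTP1 : TP 1 = TPerfOf Lc (KPerf Lc (sfStep Lc) (smStep 3 Lc) 1) (SPerfOf (sfStep Lc) (smStep 3 Lc) S 1)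
      (WPerfOf (sfStep Lc) (smStep 3 Lc) Wt 1) := by
    simp only [hTP, pow_one]
  have hfub' : ∀ m : ℕ, 1 ≤ m → ∀ (a b : Fin 4) (z : Fin 4 → ℤ),
      TP (m + 1) a b z = ((Lc ^ m : ℕ) : ℝ) ^ 8 * dressedEntry (colOf (KPerf (d := 3) Lc (sfStep Lc) (smStep 3 Lc) m)) (TP 1)
        (((Lc ^ m : ℕ) : ℤ) • z) a b + TP m a b z + D m a b z := fun m hm a b z => by
    rw [hTP1]; exact hfub m hm a b z
  have h := secondMoment_succ_of_fubini_ward (TP := TP) (w := fun m => colOf (KPerf (d := 3) Lc (sfStep Lc) (smStep 3 Lc) m)) (N := fun m => Lc ^ m)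
    hfub' (fun m hm => Nat.pos_of_ne_zero (pow_ne_zero _ (NeZero.ne Lc)))
    (fun m hm => (entryHyps_perfCol_zero hLc hm).const) (fun m hm => (entryHyps_perfCol_zero hLc hm).lin)
    (fun m hm κ l hκl => linReproSum_perfCol_offDiag_holds hLc hm hκl) (fun m hm => (entryHyps_perfCol_zero hLc hm).absW)
    (by rw [hTP1]; exact hT) (by rw [hTP1]; exact hTsymm) (by rw [hTP1]; exact hT0) (by rw [hTP1]; exact hT1d)
    (fun m hm => hA m hm) hDA μ ν hSDF
  intro m hm
  have hm' := h m hm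
  rw [hTP1] at hm'
  simpa only [fPerf_def, TPerfOf, hTP, pow_one] using hm'

/-- [our object] **THE STEP LAW IN CLASS CURRENCY, K-SIDE UNCONDITIONAL, WITHOUT THE REFLECTION ROW** (`d = 3`, `2 ≤ Lc`): `StepLawKHolds.fPerf_succ_of_fubini_flip_holdsK`
with `hRf : AxisReflectionCovariant (flipK (TPerf 1))` REPLACED by the transposition symmetry `hTsymm` of the perfect one-step kernel — (T0) and the diagonal (T1)
come from the Ward row `hWf` alone (§2).  REMAINING (displayed): class data of the perfect stencils ∕ tables (every `m ≥ 1`), `hWf`, `hTsymm`, Fubini∞ `hfub` + `hDA`,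
(SDF)∞ `hSDF`. -/
theorem fPerf_succ_of_fubini_wardFlip_holdsK (hLc : 2 ≤ Lc)
    (hSinf : ∀ m : ℕ, 1 ≤ m → ∃ Cs δS : ℝ, 0 < δS ∧ LocStencil (SPerfOf (sfStep Lc) (smStep 3 Lc) S m) Cs δS)
    (hWinf : ∀ m : ℕ, 1 ≤ m → ∃ Cw δW : ℝ, 0 < δW ∧ VertexFamily₂ (WPerfOf (sfStep Lc) (smStep 3 Lc) Wt m) (Lc ^ m) Cw δW)
    (hWf : WardTransversal (flipK (TPerfOf Lc (KPerf Lc (sfStep Lc) (smStep 3 Lc) 1) (SPerfOf (sfStep Lc) (smStep 3 Lc) S 1)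
      (WPerfOf (sfStep Lc) (smStep 3 Lc) Wt 1))))
    (hTsymm : ∀ a b t, TPerfOf Lc (KPerf Lc (sfStep Lc) (smStep 3 Lc) 1) (SPerfOf (sfStep Lc) (smStep 3 Lc) S 1)
        (WPerfOf (sfStep Lc) (smStep 3 Lc) Wt 1) a b t
      = TPerfOf Lc (KPerf Lc (sfStep Lc) (smStep 3 Lc) 1) (SPerfOf (sfStep Lc) (smStep 3 Lc) S 1) (WPerfOf (sfStep Lc) (smStep 3 Lc) Wt 1) b a (-t))
    (hDA : ∀ m : ℕ, 1 ≤ m → ∀ a b, AbsMoment₂ (D m a b))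
    (hfub : ∀ m : ℕ, 1 ≤ m → ∀ (a b : Fin 4) (z : Fin 4 → ℤ),
      TPerfOf (Lc ^ (m + 1)) (KPerf Lc (sfStep Lc) (smStep 3 Lc) (m + 1)) (SPerfOf (sfStep Lc) (smStep 3 Lc) S (m + 1))
          (WPerfOf (sfStep Lc) (smStep 3 Lc) Wt (m + 1)) a b z
        = ((Lc ^ m : ℕ) : ℝ) ^ 8 * dressedEntry (colOf (KPerf (d := 3) Lc (sfStep Lc) (smStep 3 Lc) m))
            (TPerfOf Lc (KPerf Lc (sfStep Lc) (smStep 3 Lc) 1) (SPerfOf (sfStep Lc) (smStep 3 Lc) S 1) (WPerfOf (sfStep Lc) (smStep 3 Lc) Wt 1))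
            (((Lc ^ m : ℕ) : ℤ) • z) a b
          + TPerfOf (Lc ^ m) (KPerf Lc (sfStep Lc) (smStep 3 Lc) m) (SPerfOf (sfStep Lc) (smStep 3 Lc) S m) (WPerfOf (sfStep Lc) (smStep 3 Lc) Wt m) a b z
          + D m a b z)
    (μ ν : Fin 4) (hSDF : ∀ m : ℕ, 1 ≤ m → secondMoment (D m) μ ν = 0) :
    ∀ m : ℕ, 1 ≤ m → fPerf Lc (sfStep Lc) (smStep 3 Lc) S Wt μ ν (m + 1) =
      fPerf Lc (sfStep Lc) (smStep 3 Lc) S Wt μ ν m + fPerf Lc (sfStep Lc) (smStep 3 Lc) S Wt μ ν 1 := by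
  obtain ⟨CK1, δK1, hδK1, hK1⟩ := exists_decays_KPerf_holds hLc (m := 1) le_rfl
  obtain ⟨Cs1, δS1, hδS1, hS1⟩ := hSinf 1 le_rfl
  obtain ⟨Cw1, δW1, hδW1, hW1'⟩ := hWinf 1 le_rfl
  have hW1 : VertexFamily₂ (WPerfOf (sfStep Lc) (smStep 3 Lc) Wt 1) Lc Cw1 δW1 := by simpa only [pow_one] using hW1'
  have hT : ∀ a b, AbsMoment₂ (TPerfOf Lc (KPerf Lc (sfStep Lc) (smStep 3 Lc) 1) (SPerfOf (sfStep Lc) (smStep 3 Lc) S 1)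
      (WPerfOf (sfStep Lc) (smStep 3 Lc) Wt 1) a b) :=
    absMoment₂_TPerfOf (n := Lc) hK1 hδK1 hS1 hδS1 hW1 hδW1
  obtain ⟨hT0, hT1d⟩ := wardDiag_of_ward_flip hT hWf
  have hA : ∀ m : ℕ, 1 ≤ m → ∀ a b, AbsMoment₂ (TPerfOf (Lc ^ m) (KPerf Lc (sfStep Lc) (smStep 3 Lc) m) (SPerfOf (sfStep Lc) (smStep 3 Lc) S m)
      (WPerfOf (sfStep Lc) (smStep 3 Lc) Wt m) a b) := fun m hm => by
    obtain ⟨CKm, δKm, hδKm, hKm⟩ := exists_decays_KPerf_holds hLc hm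
    obtain ⟨Csm, δSm, hδSm, hSm⟩ := hSinf m hm
    obtain ⟨Cwm, δWm, hδWm, hWm⟩ := hWinf m hm
    exact absMoment₂_TPerfOf (n := Lc ^ m) hKm hδKm hSm hδSm hWm hδWm
  exact fPerf_succ_of_fubini_ward_holdsK S Wt hLc hT hTsymm hT0 hT1d hA hDA hfub μ ν hSDF

end Perfect

end Summit.QuantumFields.BalabanUV.Beta.FP.StepLawWard

end
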